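import Summits.KontsevichZagierPeriods.KontsevichZagierPeriods.Theses.InverseLandau

/-!
# Crux `TateLifting` (stmt-KontsevichZagierPeriods-9129) — BIRTH SKELETON `Lines/birth.lean`

Route `route-KontsevichZagierPeriods-InverseLandau`, crux decl
`Summit.KontsevichZagierPeriods.KontsevichZagierPeriods.Theses.InverseLandau.TateLifting`
(rank 0, `kind.auto-crux: conjecture-grade`; the route's declared GPC-strength half:
`ker KZ.eval ≤ KZ.relations ⊔ closure T`, `T` = fibres of identically vanishing admissible Tate
families at real-algebraic parameters).

Skeleton registrar (unit `skel-stmt-KontsevichZagierPeriods-9129`, 2026-08-17). Shape (BC3):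
three NAMED stubs `stub_*` (the only `sorry`s of the file) and the kernel-checked composition
`TateLifting_of : TateLifting` concluding the crux BY NAME from the three registered stubs, through the
hypothesis-form real proof `presentation_then_lift : CubeCells → CubeResolution → CubeRegularLifting →
(∀ c, KZ.eval c = 0 → c ∈ KZ.relations ⊔ closure tateFibres)` (= the crux unfolded, `tateLifting_iff`).

## The line: NORMALISE TO AYOUB'S CUBE PRESENTATION, THEN LIFT NORMAL FORMS

* `stub_cubeCells : CubeCells` (size L–XL; accessible) — every formal `ℤ`-combination of integral
  representations is congruent modulo the four moves to ONE representation whose domain is the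
  open unit cube `(0,1)ⁿ` and whose integrand is real-analytic (hence Nash: it is `ℚ`-semialgebraic)
  on the open cube. Mechanism: cylindrical decomposition adapted to the domain and to the
  non-analyticity locus of the integrand — every cell is semialgebraically (indeed Nash-)
  diffeomorphic to an open cube [Basu–Pollack–Roy 2006, Prop. 5.3, Thm. 5.19; Cor. 5.51],
  lower-dimensional cells are Lebesgue-null (hence relations by domain additivity), the cell ↦ cube
  straightenings are `changeOfVariablesRel` moves, and finitely many cube representations of
  various dimensions merge into one (slab padding = `newtonLeibnizRel`, `KZCalculusProofs`'
  `exists_integralRep_sub_holds` pattern; same-dimension cubes add by `integrandAddRel`).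
* `stub_cubeResolution : CubeResolution` (size XL; accessible) — a cube-cell representation is
  congruent modulo the moves to ONE CUBE-REGULAR representation: domain `(0,1)ᵐ`, integrand the
  restriction of a function holomorphic on a neighbourhood of the CLOSED UNIT POLYDISC `𝔻̄ᵐ ⊆ ℂᵐ`
  — exactly the shape `𝒪_alg(𝔻̄ᵐ)` of Ayoub's presentation of all effective periods
  [Ayoub 2014, Def. 9–10, Prop. 11 and Rem. 12 ("easy to prove that this morphism is
  surjective"); Huber–Müller-Stach, Def. 13.2.20, Prop. 13.2.21] (algebraicity over `ℚ̄(z)` is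
  automatic here from `ℚ`-semialgebraicity of the real restriction). Mechanism: embedded resolution
  / rectilinearization of the boundary singularities of a Nash integrand [Bierstone–Milman 1988,
  Thm. 0.2 and Thm. 4.4: after finitely many blowings-up and power substitutions the integrand times
  the Jacobian is a monomial times an analytic unit], absolute integrability forces exponents `> −1`,
  a power substitution makes them non-negative integers, and SUBDIVISION of the cube into small
  cubes rescaled to the unit cube (domain additivity + affine changes of variables) pushes the
  complex singularities outside the closed unit polydisc. Every step is a move (1a), (2) or (3).
* `stub_cubeRegularLifting : CubeRegularLifting` (CONJECTURE-GRADE; the hardest stub) — a single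
  cube-regular representation of value `0` lies in `KZ.relations ⊔ closure T`. This is the crux read
  on Ayoub normal forms: by [Ayoub 2014, Rem. 13] Kontsevich–Zagier's Conjecture 1 is EQUIVALENT to
  the injectivity of `Ev : 𝒫 = 𝒫^eff[2πi⁻¹] → ℂ`, `𝒫^eff = 𝒪_alg(𝔻̄^∞)/⟨∂g/∂zᵢ − g|_{zᵢ=1} + g|_{zᵢ=0}⟩`,
  so modulo (i) the `2πi`-localisation and (ii) the specialisation of Ayoub's Stokes generators with
  real-algebraic data to Newton–Leibniz moves (accessible; cf. the landed `DlogLoopRelator`,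
  cylinder and polytope engines of this crux's `Lines/Sketch.lean`), this stub IS the absolute
  conjecture on cube-regular integrands, and the route's lever (deformation of a vanishing
  cube-regular integrand `G(z)` into an identically vanishing rational/algebraic family reaching a
  Tate corner, inverse Landau) is the only proposed attack. It is implied outright by the summit
  (kernel form: `of r ∈ relations`), and `TateLifting → CubeRegularLifting` (special case,
  `cubeRegularLifting_of_tateLifting` below); conversely it gives the crux only THROUGH the two
  presentation stubs — no stub is the crux or the summit on its own (BC3 probes, folder `bc/`).

Honesty record (census `STRATEGY-CENSUS.md` of this crux, 2026-08-17): the crux sits in the proved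
sandwich `Summit → TateLifting`, `TateFamilyKernel → (TateLifting ↔ Summit)`; every exact
decomposition of it has one conjecture-grade piece. This skeleton does not pretend otherwise: it
isolates the conjecture-grade content on the smallest natural class of inputs (Ayoub's
`𝒪_alg(𝔻̄ⁿ)` cube integrands, where the route's Tate-family lever and Ayoub's relative theorem
live) and exposes two accessible, independently valuable presentation theorems of the fixed KZ
calculus as the other stubs. The census's typed normal form `CubeRegularNormalForm` asked for a
RATIONAL integrand `P/Q`, `Q ≠ 0` on the closed cube; that is NOT used here: integrals of closed-cube-
regular rational functions are periods of the mixed Tate-free-of-weight-one motives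
`Hⁿ(𝔸ⁿ ∖ {Q = 0}, cube faces)` (graded weights `0` and `≥ 2`), so by weight bookkeeping under
Grothendieck's period conjecture a bare weight-one period (a real elliptic period
`∫₀¹ dx/√(1 − x⁴)`) is not of that form — the rational normal form is GPC-implausible, Ayoub's
analytic-algebraic one is a theorem in print at the level of abstract periods.

Disproof used: none exists — `ledger crux ls stmt-KontsevichZagierPeriods-9129` (2026-08-17) lists
no `Disproof.lean`; the one structural obstruction any disprover records (`TateLifting` is implied by
the summit with the empty fibre combination, so a counterexample refutes Conjecture 1) is honoured:
no stub asserts more than the summit implies except the two presentation stubs, which assert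
move-equivalences of EQUAL-valued representations constructed by resolution, never an identity
between independently given periods.

`lean check` (farm): rc 0, sorries = 3 = stubs (`stub_cubeCells`, `stub_cubeResolution`,
`stub_cubeRegularLifting`), zero elsewhere; `TateLifting_of` concludes
`Summit.KontsevichZagierPeriods.KontsevichZagierPeriods.Theses.InverseLandau.TateLifting` by name.
-/

set_option linter.dupNamespace false

noncomputable section

namespace Summit.KontsevichZagierPeriods.KontsevichZagierPeriods.Cruxes.TateLifting.Birth

open Literature.NumberTheory.Transcendental
open Summit.KontsevichZagierPeriods.KontsevichZagierPeriods.Theses.InverseLandau (TateLifting)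

/-! ## Vocabulary -/

/-- The open unit cube `(0,1)ⁿ ⊆ ℝⁿ` (the domain of every Tate fibre of the crux). [folklore] -/
def openCube (n : ℕ) : Set (Fin n → ℝ) :=
  Set.pi Set.univ fun _ : Fin n => Set.Ioo (0 : ℝ) 1

/-- The crux's generating set `T` of TATE FIBRES, verbatim from `TateLifting`: the fibre
`[(0,1)ⁿ, P/Q(·,ϖ₀)]` at a real-algebraic `ϖ₀ ∈ (0,ε)` of a rational Tate family (`Q(z,0) ≡ c₀ ≠ 0`)
admissible on `(0,ε)` whose fibre integrals vanish identically on `(0,ε)`.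
[cite: KontsevichZagier2001, §1.2] -/
def tateFibres : Set KZ.FormalRep :=
  {d : KZ.FormalRep | ∃ (n : ℕ) (P Q : MvPolynomial (Fin (n + 1)) ℚ) (ε ϖ₀ : ℝ)
      (r : KZ.IntegralRep n), 0 < ε ∧
    (∃ c₀ : ℚ, c₀ ≠ 0 ∧ ∀ z : Fin n → ℝ,
      MvPolynomial.aeval (Fin.snoc z (0 : ℝ) : Fin (n + 1) → ℝ) Q = (c₀ : ℝ)) ∧
    (∀ (z : Fin n → ℝ) (ϖ : ℝ), (∀ i, z i ∈ Set.Icc (0 : ℝ) 1) → ϖ ∈ Set.Ioo 0 ε →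
      MvPolynomial.aeval (Fin.snoc z ϖ : Fin (n + 1) → ℝ) Q ≠ 0) ∧
    (∀ ϖ ∈ Set.Ioo (0 : ℝ) ε, ∫ z in Set.pi Set.univ (fun _ : Fin n => Set.Ioo (0 : ℝ) 1),
      MvPolynomial.aeval (Fin.snoc z ϖ : Fin (n + 1) → ℝ) P /
        MvPolynomial.aeval (Fin.snoc z ϖ : Fin (n + 1) → ℝ) Q = 0) ∧
    IsAlgebraic ℚ ϖ₀ ∧ ϖ₀ ∈ Set.Ioo 0 ε ∧
    r.domain = Set.pi Set.univ (fun _ : Fin n => Set.Ioo (0 : ℝ) 1) ∧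
    Set.EqOn r.integrand (fun z => MvPolynomial.aeval (Fin.snoc z ϖ₀ : Fin (n + 1) → ℝ) P /
      MvPolynomial.aeval (Fin.snoc z ϖ₀ : Fin (n + 1) → ℝ) Q) r.domain ∧
    d = KZ.of r}

/-- `TateLifting` is literally `ker eval ≤ relations ⊔ closure tateFibres`. [folklore] -/
theorem tateLifting_iff :
    TateLifting ↔ ∀ c : KZ.FormalRep, KZ.eval c = 0 →
      c ∈ KZ.relations ⊔ AddSubgroup.closure tateFibres :=
  Iff.rfl

/-- CUBE-CELL SHAPE: domain the open unit cube, integrand real-analytic on the open cube (being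
`ℚ`-semialgebraic there, it is then a Nash function on `(0,1)ⁿ`; all singularities sit on the
boundary). [cite: BasuPollackRoy2006, Prop. 5.3] -/
def IsCubeCell {n : ℕ} (r : KZ.IntegralRep n) : Prop :=
  r.domain = openCube n ∧ AnalyticOnNhd ℝ r.integrand (openCube n)

/-- CUBE-REGULAR (AYOUB) SHAPE: domain the open unit cube, integrand the real restriction of a
function holomorphic on an open neighbourhood of the closed unit polydisc
`𝔻̄ⁿ = {w ∈ ℂⁿ | ‖w‖_∞ ≤ 1}` — the shape `𝒪_alg(𝔻̄ⁿ)` of Ayoub's presentation of effective periods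
(algebraicity over `ℚ̄(z)` follows from the `ℚ`-semialgebraicity built into `KZ.IntegralRep`).
[cite: Ayoub2014, Def. 9] -/
def IsCubeRegular {n : ℕ} (r : KZ.IntegralRep n) : Prop :=
  r.domain = openCube n ∧
    ∃ (U : Set (Fin n → ℂ)) (G : (Fin n → ℂ) → ℂ), IsOpen U ∧
      Metric.closedBall (0 : Fin n → ℂ) 1 ⊆ U ∧ DifferentiableOn ℂ G U ∧
      ∀ x ∈ r.domain, ((r.integrand x : ℝ) : ℂ) = G (fun i => ((x i : ℝ) : ℂ))

/-! ## Stub statements (as `Prop`s, so that the composition is readable) -/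

/-- CELL NORMAL FORM (stub 1): every formal combination is congruent modulo the moves to ONE
cube-cell representation. Cylindrical decomposition with Nash cells + straightening + merging.
[cite: BasuPollackRoy2006, Thm. 5.19] -/
def CubeCells : Prop :=
  ∀ c : KZ.FormalRep, ∃ (n : ℕ) (r : KZ.IntegralRep n), IsCubeCell r ∧ c - KZ.of r ∈ KZ.relations

/-- RESOLUTION TO AYOUB'S SHAPE (stub 2): a cube-cell representation is congruent modulo the moves
to ONE cube-regular representation (possibly in another dimension). Rectilinearization of the
boundary singularities + power substitutions + subdivision/rescaling; the move-internal form of the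
(easy) surjectivity half of Ayoub's `𝒫_Ay ≃ 𝒫_KZ`.
[cite: Ayoub2014, Prop. 11 and Rem. 12] [cite: BierstoneMilman1988, Thm. 0.2] -/
def CubeResolution : Prop :=
  ∀ (n : ℕ) (r : KZ.IntegralRep n), IsCubeCell r →
    ∃ (m : ℕ) (r' : KZ.IntegralRep m), IsCubeRegular r' ∧ KZ.of r - KZ.of r' ∈ KZ.relations

/-- LIFTING OF AYOUB NORMAL FORMS (stub 3, conjecture-grade): a cube-regular representation of
value `0` lies in `relations ⊔ closure T`. The crux read on `𝒪_alg(𝔻̄ⁿ)`-integrands; by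
[Ayoub 2014, Rem. 13] the injectivity of `Ev` on `𝒪_alg(𝔻̄^∞)/⟨∂g/∂zᵢ − g|₁ + g|₀⟩[2πi⁻¹]` is
EQUIVALENT to Conjecture 1, so this is the GPC-strength content of the crux, isolated on the inputs
where the route's Tate-family deformation lever applies. [cite: Ayoub2014, Rem. 13]
[cite: KontsevichZagier2001, §1.2 Conjecture 1] -/
def CubeRegularLifting : Prop :=
  ∀ (n : ℕ) (r : KZ.IntegralRep n), IsCubeRegular r → r.value = 0 →
    KZ.of r ∈ KZ.relations ⊔ AddSubgroup.closure tateFibres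

/-! ## Stubs -/

/-- stub 1 — `CubeCells` (size L–XL; semialgebraic cylindrical decomposition with Nash cells,
cell straightening as change-of-variables moves, null cells and merging). OPEN.
[cite: BasuPollackRoy2006, Thm. 5.19] -/
theorem stub_cubeCells : CubeCells := by
  sorry

/-- stub 2 — `CubeResolution` (size XL; rectilinearization / embedded resolution of boundary
singularities, power substitutions, subdivision into small cubes rescaled into the unit polydisc).
OPEN. [cite: BierstoneMilman1988, Thm. 0.2] [cite: Ayoub2014, Rem. 12] -/
theorem stub_cubeResolution : CubeResolution := by
  sorry

/-- stub 3 — `CubeRegularLifting` (conjecture-grade: the crux on Ayoub normal forms; the HARDEST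
stub, attacked by the route's inverse-Landau deformation to a Tate corner). OPEN.
[cite: Ayoub2014, Rem. 13] [cite: KontsevichZagier2001, §1.2 Conjecture 1] -/
theorem stub_cubeRegularLifting : CubeRegularLifting := by
  sorry

/-! ## Composition -/

/-- **Presentation, then lifting** (the real proof of the line, stated over the stub SIGNATURES and
concluding the crux in its unfolded membership form `tateLifting_iff`): normalise `c ∈ ker eval` to a
single cube-cell representation (stub 1), resolve it to a single cube-regular one `r'` (stub 2);
soundness of the moves (`KZ.relations_le_ker_eval_holds`) transports `eval c = 0` to
`r'.value = 0`; stub 3 puts `[r']` in `relations ⊔ closure T`, and `c = (c − [r']) + [r']`.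
[folklore] -/
theorem presentation_then_lift (h₁ : CubeCells) (h₂ : CubeResolution) (h₃ : CubeRegularLifting) :
    ∀ c : KZ.FormalRep, KZ.eval c = 0 → c ∈ KZ.relations ⊔ AddSubgroup.closure tateFibres := by
  intro c hc
  obtain ⟨n, r, hr, hcr⟩ := h₁ c
  obtain ⟨m, r', hr', hrr'⟩ := h₂ n r hr
  have hcr' : c - KZ.of r' ∈ KZ.relations := by
    have h := KZ.relations.add_mem hcr hrr'
    rwa [sub_add_sub_cancel] at h
  have hv : r'.value = 0 := by
    have hker : KZ.eval (c - KZ.of r') = 0 := KZ.relations_le_ker_eval_holds hcr'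
    rwa [map_sub, hc, zero_sub, neg_eq_zero, KZ.eval_of] at hker
  have h := add_mem (AddSubgroup.mem_sup_left (T := AddSubgroup.closure tateFibres) hcr')
    (h₃ m r' hr' hv)
  rwa [sub_add_cancel] at h

/-- **The line closes the crux modulo its stubs**: `TateLifting` BY NAME from the three registered
stubs `stub_cubeCells`, `stub_cubeResolution`, `stub_cubeRegularLifting` (the only `sorry`s of the
file) through `presentation_then_lift`. [folklore] -/
theorem TateLifting_of : TateLifting :=
  tateLifting_iff.mpr
    (presentation_then_lift stub_cubeCells stub_cubeResolution stub_cubeRegularLifting)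

/-! ## Calibration (no `sorry` below): the lifting stub is a special case of the crux, and the two
presentation stubs alone give every formal combination an Ayoub normal form. -/

/-- `TateLifting → CubeRegularLifting`: the lifting stub is implied by the crux (hence by the
summit), so it is conjecture-grade but not stronger than what the route already declared.
[folklore] -/
theorem cubeRegularLifting_of_tateLifting (h : TateLifting) : CubeRegularLifting :=
  fun _ r _ hv => h (KZ.of r) (by rw [KZ.eval_of, hv])

/-- The two presentation stubs compose to the AYOUB NORMAL FORM of formal combinations: every
`c` is congruent modulo the moves to one cube-regular representation (with the same value).
[cite: Ayoub2014, Prop. 11] -/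
theorem exists_cubeRegular_of_presentation (h₁ : CubeCells) (h₂ : CubeResolution)
    (c : KZ.FormalRep) :
    ∃ (m : ℕ) (r' : KZ.IntegralRep m), IsCubeRegular r' ∧ c - KZ.of r' ∈ KZ.relations := by
  obtain ⟨n, r, hr, hcr⟩ := h₁ c
  obtain ⟨m, r', hr', hrr'⟩ := h₂ n r hr
  refine ⟨m, r', hr', ?_⟩
  have h := KZ.relations.add_mem hcr hrr'
  rwa [sub_add_sub_cancel] at h

end Summit.KontsevichZagierPeriods.KontsevichZagierPeriods.Cruxes.TateLifting.Birth

end
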